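import Mathlib
import Summits.Ventures.PercRepro.TriangleCapThirdOrderTenLocus
import Summits.Ventures.PercRepro.TriangleCapFourRowThreePieces

/-!
# PercRepro — THE THIRD ORDER ON THE DIAGONAL CELL `(11, 3, 0)`: a `K₄⁻`-free graph with `24` edges on `11` vertices
is `3`-bipartite, or `4`-bipartite, or at least `28` below `m k` (p3, gen 46; part 199o). The census (kit j316862, §10bz(j)) has the graphs on `(11, 24)` that are neither `3`- nor `4`-bipartite at gap
`≥ 32` (`2,806,650` maximisers). Here the bound `28`, what the row `a = 4` at `r = 4` needs at its corner: the cap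
`8` makes `D` `3`-bipartite; degrees in `[4, 7]` give `k (k − 7) = 44` by the convexity of the row `4`; a vertex `z` of
degree `d ≤ 3` is deleted onto `10` vertices: `d = 0`: `D − z` on the diagonal `(10, 4, 0)` — `K_{4,6}` (then `D` is
`4`-bipartite) or `≤ 232`; `d = 1`: `(10, 4, 1)` — `4`-bipartite (the neighbour on the `4`-side: `D` `4`-bipartite;
off it: `D` `5`-bipartite with `6` missing pairs, not a star: `≤ 232`) or `≤ 208` with `T ≤ 6`; `d = 2`: `(10, 4, 2)`
— `4`-bipartite (all on / all off / mixed with `T ≤ 10`) or `≤ 204` with `T ≤ 12`; `d = 3`: `(10, 21)` at third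
order (part 199a) — `K_{3,7}` (`D` `3`- or `4`-bipartite), `4`-bipartite (as before, `T ≤ 14`), or `≤ 190` with
`T ≤ 18`, where `T = 18` means three neighbours of degree `7` around `z`, which the degree sequence forbids below
`240` (`no_three_seven_three`), so `T ≤ 17` and `190 + 34 + 12 = 236 = m k − 28`. Axioms: standard. -/

namespace PercRepro

namespace TriangleCap

namespace C047

open Finset

variable {V : Type*} [Fintype V] [DecidableEq V]

omit [Fintype V] in
/-- The explicit lift of a side: the neighbours of `z` all off `A'` make `insert z A'` a side of `D`. -/
theorem bipSub_insert_map (D : SimpleGraph V) (z : V) (A' : Finset {v : V // v ≠ z})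
    (hsub : BipSub (del D z) A') (hnb : ∀ w : {v : V // v ≠ z}, D.Adj w.1 z → w ∉ A') :
    BipSub D (insert z (A'.map (Function.Embedding.subtype _))) := by
  have hmem : ∀ x : {v : V // v ≠ z}, x.1 ∈ A'.map (Function.Embedding.subtype _) ↔ x ∈ A' := fun x =>
    mem_map' _
  intro x y hxy
  by_cases hxz : x = z
  · subst hxz
    have hyz : y ≠ x := fun h => D.irrefl (h ▸ hxy)
    have hy := hnb ⟨y, hyz⟩ (D.adj_symm hxy)
    rw [mem_insert, mem_insert, hmem ⟨y, hyz⟩]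
    tauto
  by_cases hyz : y = z
  · subst hyz
    have hx := hnb ⟨x, hxz⟩ hxy
    rw [mem_insert, mem_insert, hmem ⟨x, hxz⟩]
    tauto
  have h := hsub ⟨x, hxz⟩ ⟨y, hyz⟩ ((del_adj D z _ _).mpr hxy)
  rw [mem_insert, mem_insert, hmem ⟨x, hxz⟩, hmem ⟨y, hyz⟩]
  tauto

omit [Fintype V] in
/-- `|insert z A'| = |A'| + 1`. -/
theorem card_insert_map (z : V) (A' : Finset {v : V // v ≠ z}) :
    (insert z (A'.map (Function.Embedding.subtype _))).card = A'.card + 1 := by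
  have hz : z ∉ A'.map (Function.Embedding.subtype _) := by
    rw [mem_map]
    rintro ⟨x, _, hx⟩
    exact x.2 hx
  rw [card_insert_of_notMem hz, card_map]

/-- A spanning subgraph of `K(A, Aᶜ)` with `r ≥ 1` missing pairs has a missing pair. -/
theorem exists_missing_pair (H : SimpleGraph V) [DecidableRel H.Adj] (A : Finset V) (hH : BipSub H A) (a r : ℕ)
    (hA : A.card = a) (hm : H.edgeFinset.card + r = a * (Fintype.card V - a)) (hr : 1 ≤ r) :
    ∃ p q, p ∈ A ∧ q ∉ A ∧ ¬ H.Adj p q := by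
  by_contra hcon
  push Not at hcon
  have hbot : missingGraph H A = ⊥ := by
    ext x y
    rw [missingGraph_adj]
    simp only [SimpleGraph.bot_adj, iff_false, not_and, not_not]
    intro hxy
    by_cases hx : x ∈ A
    · exact hcon x y hx (by tauto)
    · have hy : y ∈ A := by tauto
      exact H.adj_symm (hcon y x hy hx)
  have h := card_edges_missingGraph H A hH a r hA hm
  have hempty : (missingGraph H A).edgeFinset = ∅ := SimpleGraph.edgeFinset_eq_empty.mpr hbot
  rw [hempty, card_empty] at h
  omega

omit [Fintype V] in
/-- **NO MISSING STAR AFTER THE INSERTION:** with the neighbours of `z` all off `A'`, a missing pair of `D − z`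
(not at `z`) and two non-neighbours of `z` off `A'`, the missing pairs of `D` in `K(insert z A', …)` are not a star. -/
theorem not_missingStar_insert (D : SimpleGraph V) [DecidableRel D.Adj] (z : V) (A' : Finset {v : V // v ≠ z})
    (p q : {v : V // v ≠ z}) (hp : p ∈ A') (hq : q ∉ A')
    (hpq : ¬ D.Adj p.1 q.1) (w₁ w₂ : {v : V // v ≠ z}) (h12 : w₁ ≠ w₂) (hw₁ : w₁ ∉ A') (hw₂ : w₂ ∉ A')
    (hw₁z : ¬ D.Adj z w₁.1) (hw₂z : ¬ D.Adj z w₂.1) :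
    ¬ ∃ v, MissingStar D (insert z (A'.map (Function.Embedding.subtype _))) v := by
  have hmem : ∀ x : {v : V // v ≠ z}, x.1 ∈ A'.map (Function.Embedding.subtype _) ↔ x ∈ A' := fun x =>
    mem_map' _
  have hz : z ∉ A'.map (Function.Embedding.subtype _) := by
    rw [mem_map]
    rintro ⟨x, _, hx⟩
    exact x.2 hx
  rintro ⟨v, hv⟩
  have hzA : z ∈ insert z (A'.map (Function.Embedding.subtype _)) := mem_insert_self _ _
  have hoff : ∀ x : {v : V // v ≠ z}, x ∉ A' → x.1 ∉ insert z (A'.map (Function.Embedding.subtype _)) := by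
    intro x hx
    rw [mem_insert, hmem x]
    push Not
    exact ⟨x.2, hx⟩
  have h1 := hv z w₁.1 hzA (hoff w₁ hw₁) hw₁z
  have h2 := hv z w₂.1 hzA (hoff w₂ hw₂) hw₂z
  have hpA : p.1 ∈ insert z (A'.map (Function.Embedding.subtype _)) := mem_insert_of_mem ((hmem p).mpr hp)
  have h3 := hv p.1 q.1 hpA (hoff q hq) hpq
  rcases h1 with h1 | h1
  · rcases h3 with h3 | h3
    · exact p.2 (h3.trans h1.symm)
    · exact q.2 (h3.trans h1.symm)
  · rcases h2 with h2 | h2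
    · exact w₁.2 (h1.trans h2.symm)
    · exact h12 (Subtype.ext (h1.trans h2.symm))

/-- Two non-neighbours of `z` off `A'` exist when `|A'| + d(z) + 2 ≤ k − 1`. -/
theorem exists_two_nonnbhd_off (D : SimpleGraph V) [DecidableRel D.Adj] (z : V) (A' : Finset {v : V // v ≠ z})
    (hcard : A'.card + deg D z + 2 ≤ Fintype.card {v : V // v ≠ z}) :
    ∃ w₁ w₂ : {v : V // v ≠ z}, w₁ ≠ w₂ ∧ w₁ ∉ A' ∧ w₂ ∉ A' ∧ ¬ D.Adj z w₁.1 ∧ ¬ D.Adj z w₂.1 := by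
  obtain ⟨Q, hQ⟩ : ∃ Q : Finset {v : V // v ≠ z},
      Q = univ.filter (fun w : {v : V // v ≠ z} => w ∉ A' ∧ ¬ D.Adj w.1 z) := ⟨_, rfl⟩
  have hmemQ : ∀ w, w ∈ Q ↔ w ∉ A' ∧ ¬ D.Adj w.1 z := fun w => by
    rw [hQ, mem_filter]
    simp only [mem_univ, true_and]
  have hNz := card_nbhd_del D z
  have hcover : univ ⊆ A' ∪ univ.filter (fun w : {v : V // v ≠ z} => D.Adj w.1 z) ∪ Q := by
    intro w _
    rw [mem_union, mem_union, mem_filter, hmemQ]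
    by_cases h1 : w ∈ A'
    · exact Or.inl (Or.inl h1)
    by_cases h2 : D.Adj w.1 z
    · exact Or.inl (Or.inr ⟨mem_univ _, h2⟩)
    · exact Or.inr ⟨h1, h2⟩
  have h := card_le_card hcover
  rw [card_univ] at h
  have h2 := card_union_le (A' ∪ univ.filter (fun w : {v : V // v ≠ z} => D.Adj w.1 z)) Q
  have h3 := card_union_le A' (univ.filter (fun w : {v : V // v ≠ z} => D.Adj w.1 z))
  have hQ2 : 2 ≤ Q.card := by omega
  obtain ⟨w₁, hw₁, w₂, hw₂, h12⟩ := one_lt_card.mp (by omega : 1 < Q.card)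
  rw [hmemQ] at hw₁ hw₂
  exact ⟨w₁, w₂, h12, hw₁.1, hw₂.1, fun h => hw₁.2 (D.adj_symm h), fun h => hw₂.2 (D.adj_symm h)⟩

/-- Three neighbours of degree `7` around a vertex of degree `3` on `(11, 24)`: `Σ_v d(v)² ≥ 9 + 147 + 84 = 240`. -/
theorem no_three_seven_three (D : SimpleGraph V) [DecidableRel D.Adj] (hk : Fintype.card V = 11)
    (hm : D.edgeFinset.card = 24) (z : V) (hz : deg D z = 3) (h7 : ∀ w, D.Adj z w → deg D w = 7) :
    240 ≤ ∑ v, deg D v * deg D v := by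
  obtain ⟨N, hN⟩ : ∃ N : Finset V, N = univ.filter (fun w => D.Adj z w) := ⟨_, rfl⟩
  have hmemN : ∀ w, w ∈ N ↔ D.Adj z w := fun w => by rw [hN, mem_filter]; simp only [mem_univ, true_and]
  have hzN : z ∉ N := fun h => D.irrefl ((hmemN z).mp h)
  have hNcard : N.card = 3 := by rw [hN]; exact hz
  obtain ⟨S, hS⟩ : ∃ S : Finset V, S = insert z N := ⟨_, rfl⟩
  have hScard : S.card = 4 := by rw [hS, card_insert_of_notMem hzN, hNcard]
  have hdegsum := sum_deg_eq D
  rw [hm] at hdegsum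
  have hsplit : ∀ F : V → ℕ, ∑ v, F v = ∑ v ∈ S, F v + ∑ v ∈ Sᶜ, F v := fun F =>
    (sum_add_sum_compl S F).symm
  have hSdeg : ∑ v ∈ S, deg D v = 24 := by
    rw [hS, sum_insert hzN, hz]
    have : ∑ v ∈ N, deg D v = ∑ _v ∈ N, 7 := sum_congr rfl (fun w hw => h7 w ((hmemN w).mp hw))
    rw [this, sum_const, smul_eq_mul, hNcard]
  have hSsq : ∑ v ∈ S, deg D v * deg D v = 156 := by
    rw [hS, sum_insert hzN, hz]
    have : ∑ v ∈ N, deg D v * deg D v = ∑ _v ∈ N, 49 := sum_congr rfl (fun w hw => by rw [h7 w ((hmemN w).mp hw)])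
    rw [this, sum_const, smul_eq_mul, hNcard]
  have hcompl : Sᶜ.card = 7 := by rw [card_compl, hScard, hk]
  have hC : ∑ v ∈ Sᶜ, 7 * deg D v ≤ ∑ v ∈ Sᶜ, (deg D v * deg D v + 12) :=
    sum_le_sum (fun v _ => seven_mul_le_sq_add_twelve (deg D v))
  rw [← mul_sum, sum_add_distrib, sum_const, smul_eq_mul, hcompl] at hC
  rw [hsplit, hSdeg] at hdegsum
  rw [hsplit, hSsq]
  omega

/-- **THE THIRD ORDER ON `(11, 24)`:** `K₄⁻`-free, `k = 11`, `m = 24` ⇒ `D` is a spanning subgraph of some `K(A, Aᶜ)`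
with `|A| = 3`, or of one with `|A| = 4`, or `Σ_v d(v)² + 28 ≤ m k`. -/
theorem three_diag_third_order_eleven (D : SimpleGraph V) [DecidableRel D.Adj] (hK : K4mFree D)
    (hk : Fintype.card V = 11) (hm : D.edgeFinset.card = 24) :
    (∃ A : Finset V, A.card = 3 ∧ BipSub D A) ∨ (∃ A : Finset V, A.card = 4 ∧ BipSub D A) ∨
      ∑ v, deg D v * deg D v + 28 ≤ D.edgeFinset.card * Fintype.card V := by
  -- (A) the cap `8` makes `D` `3`-bipartite
  by_cases hx : ∃ x, deg D x + 3 = Fintype.card V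
  · obtain ⟨x, hx⟩ := hx
    rcases three_row_cap D hK 0 (by omega) (by omega) x hx with h | ⟨h1, -⟩
    · exact Or.inl h
    · omega
  push Not at hx
  have hcap : ∀ v, deg D v + 3 ≤ Fintype.card V := fun v =>
    deg_add_le_card_of_dense D hK 3 (by norm_num) (by omega)
      (cap_arith 3 (Fintype.card V) D.edgeFinset.card 0 (by norm_num) (by omega) (by omega)) v
  have hcap' : ∀ v, deg D v + 4 ≤ Fintype.card V := fun v => by
    have h1 := hcap v
    have h2 := hx v
    omega
  have hcap7 : ∀ v, deg D v ≤ 6 + 1 := fun v => by have := hcap' v; omega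
  -- (B) every degree `≥ 4`: `44`
  by_cases hdeg : ∀ v, 4 ≤ deg D v
  · right; right
    have h := diag_convex D (by omega) (by omega) hcap' hdeg
    rw [hk, hm] at h ⊢
    omega
  push Not at hdeg
  obtain ⟨z, hz⟩ := hdeg
  -- the deletion bookkeeping
  have hK' := k4mFree_del D hK z
  have hcard' := card_del z
  have hedges' := card_edges_del D z
  have hsq := sum_deg_sq_del D z
  have hT := sum_del_nbhd_le D z 6 hcap7
  have hNz := card_nbhd_del D z
  obtain ⟨T, hTdef⟩ : ∃ T, ∑ a : {v : V // v ≠ z}, (if D.Adj a.1 z then deg (del D z) a else 0) = T := ⟨_, rfl⟩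
  obtain ⟨S', hS'def⟩ : ∃ S', ∑ a : {v : V // v ≠ z}, deg (del D z) a * deg (del D z) a = S' := ⟨_, rfl⟩
  obtain ⟨m', hm'def⟩ : ∃ m', (del D z).edgeFinset.card = m' := ⟨_, rfl⟩
  obtain ⟨Nz, hNzdef⟩ : ∃ Nz : Finset {v : V // v ≠ z},
      Nz = univ.filter (fun a : {v : V // v ≠ z} => D.Adj a.1 z) := ⟨_, rfl⟩
  have hmemNz : ∀ a : {v : V // v ≠ z}, a ∈ Nz ↔ D.Adj a.1 z := fun a => by
    rw [hNzdef, mem_filter]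
    simp only [mem_univ, true_and]
  have hTfilt : T = ∑ a ∈ Nz, deg (del D z) a := by rw [← hTdef, hNzdef, sum_filter]
  rw [← hNzdef] at hNz
  rw [hTdef, hS'def] at hsq
  rw [hTdef] at hT
  rw [hm'def] at hedges'
  have hcardW' : Fintype.card {v : V // v ≠ z} = 10 := by omega
  have hdegNz : ∀ a ∈ Nz, deg (del D z) a ≤ 6 := fun a ha => by
    have h := deg_del D z a
    rw [if_pos ((hmemNz a).mp ha)] at h
    have := hcap7 a.1
    omega
  -- the `5`-bipartite read: the neighbours of `z` all off the `4`-side `A'` of `D − z` with `r' ≥ 1` missing pairs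
  have hnone_case : ∀ (A' : Finset {v : V // v ≠ z}) (r' : ℕ), A'.card = 4 → BipSub (del D z) A' →
      (del D z).edgeFinset.card + r' = 4 * (Fintype.card {v : V // v ≠ z} - 4) → 1 ≤ r' →
      (∀ w : {v : V // v ≠ z}, D.Adj w.1 z → w ∉ A') →
      ∑ v, deg D v * deg D v + 28 ≤ D.edgeFinset.card * Fintype.card V := by
    intro A' r' hA'card hB hm' hr' hnone
    have hAsub := bipSub_insert_map D z A' hB hnone
    have hAcard := card_insert_map z A'
    rw [hA'card] at hAcard
    obtain ⟨p, q, hp, hq, hpq⟩ := exists_missing_pair (del D z) A' hB 4 r' hA'card hm' hr'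
    obtain ⟨w₁, w₂, h12, hw₁, hw₂, hw₁z, hw₂z⟩ := exists_two_nonnbhd_off D z A' (by omega)
    have hns := not_missingStar_insert D z A' p q hp hq (fun h => hpq ((del_adj D z p q).mpr h)) w₁ w₂ h12 hw₁ hw₂
      hw₁z hw₂z
    have h := closed_form_stability_bipSub D _ hAsub 5 6 hAcard (by rw [hk, hm]) (by omega) (by norm_num) hns
    rw [hk, hm] at h ⊢
    omega
  -- the mixed count: a neighbour off `A'` has degree `≤ 4`
  have hmixed : ∀ A' : Finset {v : V // v ≠ z}, A'.card = 4 → BipSub (del D z) A' →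
      (∃ w₀ : {v : V // v ≠ z}, D.Adj w₀.1 z ∧ w₀ ∉ A') → T + 6 ≤ deg D z * 6 + 4 := by
    intro A' hA'card hB hw
    obtain ⟨w₀, hw₀z, hw₀A⟩ := hw
    have hdw₀ : deg (del D z) w₀ ≤ 4 := by
      have := deg_le_card_of_bipSub (del D z) A' hB w₀ hw₀A
      rw [hA'card] at this
      exact this
    rw [hTfilt, ← hNz]
    exact sum_le_of_mem_le Nz (fun a => deg (del D z) a) 6 ((hmemNz w₀).mpr hw₀z) hdegNz hdw₀
  -- the three-way split for a `4`-bipartite `D − z` with `r' ≥ 1`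
  have hsides : ∀ (A' : Finset {v : V // v ≠ z}) (r' : ℕ), A'.card = 4 → BipSub (del D z) A' →
      (del D z).edgeFinset.card + r' = 4 * (Fintype.card {v : V // v ≠ z} - 4) → 1 ≤ r' →
      (∃ A : Finset V, A.card = 4 ∧ BipSub D A) ∨
        (∑ v, deg D v * deg D v + 28 ≤ D.edgeFinset.card * Fintype.card V) ∨
        (T + 6 ≤ deg D z * 6 + 4) := by
    intro A' r' hA'card hB hm' hr'
    by_cases hall : ∀ a : {v : V // v ≠ z}, D.Adj a.1 z → a ∈ A'
    · obtain ⟨B, hBcard, hBsub⟩ := bipSub_lift D z A' hB hall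
      exact Or.inl ⟨B, by rw [hBcard, hA'card], hBsub⟩
    by_cases hnone : ∀ a : {v : V // v ≠ z}, D.Adj a.1 z → a ∉ A'
    · exact Or.inr (Or.inl (hnone_case A' r' hA'card hB hm' hr' hnone))
    · push Not at hall
      exact Or.inr (Or.inr (hmixed A' hA'card hB hall))
  have hd : deg D z = 0 ∨ deg D z = 1 ∨ deg D z = 2 ∨ deg D z = 3 := by omega
  rcases hd with hd0 | hd1 | hd2 | hd3
  · -- `d = 0`: `D − z` on the diagonal `(10, 4, 0)`
    have hm'24 : m' = 24 := by omega
    rcases diag_second_order_gen (del D z) hK' 4 (le_refl 4) (by omega) (by rw [hm'def, hcardW', hm'24])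
      with ⟨A', hA'card, hB⟩ | hgap
    · obtain ⟨B, hBcard, hBsub⟩ := bipSub_lift D z A' hB (fun a ha => by
        have : a ∈ Nz := (hmemNz a).mpr ha
        rw [hd0, card_eq_zero] at hNz
        rw [hNz] at this
        exact absurd this (notMem_empty a))
      exact Or.inr (Or.inl ⟨B, by rw [hBcard, hA'card], hBsub⟩)
    · right; right
      rw [hS'def, hm'def, hcardW', hm'24] at hgap
      rw [hd0] at hT
      rw [hsq, hk, hm, hd0]
      omega
  · -- `d = 1`: `D − z` on `(10, 4, 1)`
    have hm'23 : m' = 23 := by omega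
    rcases one_below_second_order_gen (del D z) hK' 4 (le_refl 4) (by omega) (by rw [hm'def, hcardW', hm'23])
      with ⟨A', hA'card, hB⟩ | hgap
    · rcases hsides A' 1 hA'card hB (by rw [hm'def, hcardW', hm'23]) (le_refl 1) with h | h | hT'
      · exact Or.inr (Or.inl h)
      · exact Or.inr (Or.inr h)
      · -- a single neighbour cannot be mixed: it is off `A'`, the `5`-bipartite read applies
        right; right
        have hS := sum_deg_sq_le_of_bipSub (del D z) A' hB 4 1 hA'card (by rw [hm'def, hcardW', hm'23])
          (by omega)
        rw [hS'def, hm'def, hcardW', hm'23] at hS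
        rw [hd1] at hT'
        rw [hsq, hk, hm, hd1]
        omega
    · right; right
      rw [hS'def, hm'def, hcardW', hm'23] at hgap
      rw [hd1] at hT
      rw [hsq, hk, hm, hd1]
      omega
  · -- `d = 2`: `D − z` on `(10, 4, 2)`
    have hm'22 : m' = 22 := by omega
    rcases four_two_second_order (del D z) hK' (by omega) (by rw [hm'def, hcardW', hm'22])
      with ⟨A', hA'card, hB⟩ | hgap
    · rcases hsides A' 2 hA'card hB (by rw [hm'def, hcardW', hm'22]) (by norm_num) with h | h | hT'
      · exact Or.inr (Or.inl h)
      · exact Or.inr (Or.inr h)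
      · right; right
        have hS := sum_deg_sq_le_of_bipSub (del D z) A' hB 4 2 hA'card (by rw [hm'def, hcardW', hm'22])
          (by omega)
        rw [hS'def, hm'def, hcardW', hm'22] at hS
        rw [hd2] at hT'
        rw [hsq, hk, hm, hd2]
        omega
    · right; right
      rw [hS'def, hm'def, hcardW', hm'22] at hgap
      rw [hd2] at hT
      rw [hsq, hk, hm, hd2]
      omega
  · -- `d = 3`: `D − z` on `(10, 21)` at third order
    have hm'21 : m' = 21 := by omega
    rw [hd3] at hT hNz
    rcases three_diag_third_order_ten (del D z) hK' hcardW' (by rw [hm'def, hm'21])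
      with ⟨A', hA'card, hA'⟩ | ⟨A', hA'card, hB⟩ | hthird
    · -- `D − z = K_{3,7}`: the three neighbours of `z` lie on one side
      have hfull : ∀ {x y : {v : V // v ≠ z}}, x ∈ A' → y ∉ A' → (del D z).Adj x y := fun hx hy =>
        adj_of_bipSub_full (del D z) A' hA' 3 hA'card (by rw [hm'def, hcardW', hm'21]) hx hy
      by_cases hall : ∀ a : {v : V // v ≠ z}, D.Adj a.1 z → a ∈ A'
      · obtain ⟨B, hBcard, hB⟩ := bipSub_lift D z A' hA' hall
        exact Or.inl ⟨B, by rw [hBcard, hA'card], hB⟩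
      · push Not at hall
        obtain ⟨a₀, ha₀z, ha₀A⟩ := hall
        have hoff : ∀ a : {v : V // v ≠ z}, D.Adj a.1 z → a ∉ A' := by
          intro a₁ ha₁z ha₁A
          have hne01 : a₀ ≠ a₁ := fun h => ha₀A (h ▸ ha₁A)
          obtain ⟨a₂, ha₂z, ha₂0, ha₂1⟩ : ∃ a₂ : {v : V // v ≠ z}, D.Adj a₂.1 z ∧ a₂ ≠ a₀ ∧ a₂ ≠ a₁ := by
            have h2 : 2 < Nz.card := by omega
            obtain ⟨b₁, hb₁, b₂, hb₂, b₃, hb₃, h12, h13, h23⟩ := two_lt_card.mp h2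
            rw [hmemNz] at hb₁ hb₂ hb₃
            by_cases e1 : b₁ = a₀ ∨ b₁ = a₁
            · by_cases e2 : b₂ = a₀ ∨ b₂ = a₁
              · refine ⟨b₃, hb₃, ?_, ?_⟩
                · intro h; rcases e1 with rfl | rfl <;> rcases e2 with rfl | rfl <;>
                    first | exact h12 rfl | exact h13 h | exact h13 h.symm | exact h23 h | exact h23 h.symm
                · intro h; rcases e1 with rfl | rfl <;> rcases e2 with rfl | rfl <;>
                    first | exact h12 rfl | exact h13 h | exact h13 h.symm | exact h23 h | exact h23 h.symm
              · push Not at e2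
                exact ⟨b₂, hb₂, e2.1, e2.2⟩
            · push Not at e1
              exact ⟨b₁, hb₁, e1.1, e1.2⟩
          have h10 : D.Adj a₁.1 a₀.1 := (del_adj D z a₁ a₀).mp (hfull ha₁A ha₀A)
          by_cases ha₂A : a₂ ∈ A'
          · have h20 : D.Adj a₂.1 a₀.1 := (del_adj D z a₂ a₀).mp (hfull ha₂A ha₀A)
            exact not_adj_both D hK (D.adj_symm ha₀z) (D.adj_symm ha₁z) (D.adj_symm h10)
              (fun h => ha₂1 (Subtype.ext h).symm) (D.adj_symm ha₂z) (D.adj_symm h20)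
          · have h12' : D.Adj a₁.1 a₂.1 := (del_adj D z a₁ a₂).mp (hfull ha₁A ha₂A)
            exact not_adj_both D hK (D.adj_symm ha₁z) (D.adj_symm ha₀z) h10
              (fun h => ha₂0 (Subtype.ext h).symm) (D.adj_symm ha₂z) h12'
        obtain ⟨B, hBcard, hB⟩ := bipSub_insert_of_nbhd_off D z A' hA' hoff
        exact Or.inr (Or.inl ⟨B, by rw [hBcard, hA'card], hB⟩)
    · -- `D − z` is `4`-bipartite on `(10, 4, 3)`
      rcases hsides A' 3 hA'card hB (by rw [hm'def, hcardW', hm'21]) (by norm_num) with h | h | hT'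
      · exact Or.inr (Or.inl h)
      · exact Or.inr (Or.inr h)
      · right; right
        have hS := sum_deg_sq_le_of_bipSub (del D z) A' hB 4 3 hA'card (by rw [hm'def, hcardW', hm'21])
          (by omega)
        rw [hS'def, hm'def, hcardW', hm'21] at hS
        rw [hd3] at hT'
        rw [hsq, hk, hm, hd3]
        omega
    · -- neither: `S' ≤ 190` and `T ≤ 17` (three neighbours of degree `7` are impossible)
      right; right
      rw [hS'def, hm'def, hcardW', hm'21] at hthird
      have hT17 : T ≤ 17 := by
        by_contra hcon
        have hT18 : T = 18 := by omega
        have h6 := eq_of_sum_eq_card_mul Nz (fun a => deg (del D z) a) 6 hdegNz (by rw [← hTfilt, hT18, hNz])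
        have h7 : ∀ w, D.Adj z w → deg D w = 7 := by
          intro w hw
          have hwz : w ≠ z := fun h => D.irrefl (h ▸ hw)
          have h := deg_del D z ⟨w, hwz⟩
          rw [if_pos (D.adj_symm hw)] at h
          have h6w : deg (del D z) ⟨w, hwz⟩ = 6 := h6 ⟨w, hwz⟩ ((hmemNz ⟨w, hwz⟩).mpr (D.adj_symm hw))
          rw [← h, h6w]
        have h240 := no_three_seven_three D hk hm z hd3 h7
        rw [hsq, hd3, hT18] at h240
        omega
      rw [hsq, hk, hm, hd3]
      omega

end C047

end TriangleCap

end PercRepro
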